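import Literature.MathematicalPhysics.QuantumFieldTheory.Balaban1983to89.B12Pairing543Backward

/-!
# Bałaban CMP 109 (1987) §5, the display (5.43) COMPLETE: leading term AND third-order remainder, by
summation by parts on `ℤ^d`

CITATION HEADER (lean-in-tree rule 2026-08-18).  Source: T. Bałaban, *Renormalization group approach to lattice
gauge field theories. I. Generation of effective actions in a small field approximation and a coupling constant
renormalization in four dimensions*, Commun. Math. Phys. **109**, 249–301 (1987), doi:10.1007/bf01215223
[Balaban1987RG1] (held: `paper:balaban1987-cmp109-rg-i-small-field`; journal page = PDF page + 248).  The displays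
and sentences quoted below were READ AS IMAGES on the 300-dpi renders of p. 291 [PDF 43], p. 297 [49] and p. 298
[50] (`HOME/b2b-balaban-ref1/pages/1987-cmp109-rg-I-small-field/…-p043-x2.png`, `…-p049-x2.png`, `…-p050-x2.png`,
HOME = the audit cell folder `run/shared/lean/pub/pub-balaban/`) and agree with the audited lineage transcript
`HOME/b2b-balaban-b03/B12s-transcript.md`.  Audit cell `pub-balaban`, unit `b2b-balaban-b03-g7` (B12 §§2–5
lineage), node B12-FORM-543; sits on top of `…B12Rep537` (`fdelta`, `wilsonQ`, `rem538`, `rep538_of_decay510`,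
`TaylorData3`, `ofReal`, `MQ`), `…B12Transverse536` (`ReflCovariant`, `WardFirst`, `taylorData3_of_symmetries`),
`…B12Pairing543` (`pairing`, `fsq`, `fdelta_comm`, `sum4_comm`), `…B12Pairing543Backward` (`curlB`, `fsqB`, `refl`,
`reflK`, `fsqB_eq_pairing_printed`, `fsq_eq_fsqB_refl`), `…B12WardLeadingForm` (`delta_comm`) and
`GawedzkiKupiainen1985.PeriodicGleason` (`Pt`, `unitVec`, `delta`, `deltaIter`, `K`, `l1`).  Value = kernel
certificate of a printed derivation step (a change of representation: no Fourier transform, no estimate beyond the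
one already certified in `B12Rep537`), NOT summit progress; nothing is asserted about the sign or size of Bałaban's
β (cell GAPS G-B12s-*, G-adv2-3; the β questions are the BETA table's, not this module's).

THE PRINTED TEXT (verbatim; NOTATION: inside quotation marks Π, Π′ are written exactly as printed — the print uses
NO tilde for the momentum-space functions of (5.11); the index letter of (5.43)/(5.44) is the print's ϱ).
* p. 291, (4.42) and the sentence before it: "This implies that the first term in (4.34), written for (4.40) instead
  of E^{(2)}, is represented as  β_j(g_{j−1})½Σ_{x,μ,ν} tr(∂δB)_{μν}(x)(∂B)_{μν}(x) + (irrelevant terms).  (4.42)".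
* p. 297: "Let us finish now the analysis of the previous section. The first term on the right-hand side of (4.34),
  after all the changes and resummations, and using (5.37), (5.38), can be written as
  Σ_{(x,μ),(y,ν)} Π_{μν}(x − y) tr δB_μ(x)B_ν(y) = β½ Σ_{x,μ,ν} tr(∂δB)_{μν}(x)(∂B)_{μν}(x)
  + Σ_{(x,μ),(y,ν),κ,λ,ϱ} [Π′_{μν,κλϱ}(x − y) tr(∂_κ∂_λ∂_ϱδB_μ)(x)B_ν(y) + Π′_{μν,κ,λϱ}(x − y) tr(∂_λ∂_ϱδB_μ)(x)(∂_κB_ν)(y)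
  + …].  (5.43)
  The analyticity properties mentioned after (5.38) imply the corresponding exponential decay properties of the
  functions in the above formula. More exactly, we have  |Π′_{μν,κλϱ}(x − y)| ≦ O(1)E₀ exp(½δ₁|x − y|).  (5.44)"
  (sic: the minus sign in the exponent is missing in print — lineage transcript note M-5.44; meant exp(−½δ₁|x − y|)).
* p. 298: "In the third order terms in (5.43) we can always shift the derivatives onto the other function, so we can
  write them in the form in which δB is differentiated once, and B twice. The bound (5.44), and the bounds (4.14),
  (4.15) for derivatives of δB, B imply that all these third order terms in (5.43) are irrelevant. Defining the
  function β_j as equal to the coefficient β in (5.43), we see that the first expression there is cancelled by the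
  first expression in (4.42)."
* The inputs (5.37)/(5.38) p. 297 and (5.10)/(5.11)/(5.15)/(5.16) p. 293 are quoted verbatim in the header of
  `…B12Rep537` (same lineage, cross-read REFEREE5 / GAPS C-ref5-9x) and are used here only BY NAME
  (`B12Rep537.rep538_of_decay510`, `B12Transverse536.rep538_of_symmetries`).

THE DICTIONARY (position space throughout; `tr` is bilinear, so the 𝔤-valued statement is the scalar one
componentwise, exactly as in `B12Pairing543`; a = δB, b = B are lattice vector fields `Fin d → Pt d → ℂ` vanishing
off finite sets).
* Left side of (5.43): `form Π a b = Σ_{μν} spair Π_{μν} a_μ b_ν`, `spair R f g = Σ'_{(x,y)} R(x − y) f(x) g(y)`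
  (a `tsum` over `ℤ^d × ℤ^d` of a finitely supported function; `spair_eq_sum`: it IS the finite double sum, and
  `form_eq_pairing`: `form K a b = B12Pairing543.pairing K A B a b` for fields vanishing off `A`, `B`).
* (5.37)/(5.38) enter in the certified coefficient form of `B12Rep537.rep538`: `Π_{μν}(z) − βQ_{μν}(z) =
  Σ_{(κ,λ,ϱ)} (Δ_κΔ_λΔ_ϱ Π′_{μν,κλϱ})(z)` with the BACKWARD-LOOKING difference `PeriodicGleason.delta`
  (`(Δ_κ R)(z) = R(z − e_κ) − R(z)`, symbol \overline{∂_κ(p)} = e^{−ip_κ} − 1 under (5.11)) on the KERNEL.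
* SUMMATION BY PARTS (`spair_delta_kernel`): a backward-looking difference on the kernel is a FORWARD difference
  `B12Rep537.fdelta` (`(∂_κ f)(x) = f(x + e_κ) − f(x)`, the series' ∂ of Bałaban CMP 95 (1984) p. 18 (1.2), cell
  NOTATION.md §2.2) on the LEFT field: `spair (Δ_κ R) f g = spair R (∂_κ f) g`; iterated (`spair_deltaIter_kernel`):
  `spair (Δ_κΔ_λΔ_ϱ R) f g = spair R (∂_κ∂_λ∂_ϱ f) g` — precisely the printed first remainder monomial
  "Π′_{μν,κλϱ}(x − y) tr(∂_κ∂_λ∂_ϱδB_μ)(x)B_ν(y)" with the print's ∂ on δB.  And (`spair_fdelta_left_eq_delta_right`)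
  a forward difference on the left field is a backward-looking one on the RIGHT field, `spair R (∂_κ f) g =
  spair R f (Δ_κ g)` — the p. 298 sentence "we can always shift the derivatives onto the other function"
  (`spair_third_order_shift`: "δB is differentiated once, and B twice").
* Leading term: by `B12Pairing543Backward.fsqB_eq_pairing_printed` the printed kernel `Q_{μν} = wilsonQ μ ν` pairs
  `a`, `b` to `fsqB a b = ½Σ_xΣ_{μν}(curlB a)_{μν}(x)(curlB b)_{μν}(x)` (curls with the backward-looking difference;
  with the series' FORWARD curls the kernel is the reflected = transposed one — the located convention slip GAPS
  G-b03g6-4 / C-b03g6-6 / C-b03g6-7, harmless; `form543_forward_of_rep` below is the forward reading).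

WHAT IS PROVED (every `theorem` kernel-checked from the definitions; `d` arbitrary; no hypothesis of the series).
* `form543_of_rep` — (5.43) COMPLETE as an identity, for ANY complex kernel family `Π` and ANY `β`, `Π′` with
  `Π_{μν} − βQ_{μν} = Σ_{(κ,λ,ϱ)} Δ_κΔ_λΔ_ϱ Π′_{μν,κλϱ}` pointwise, and all finitely supported `a`, `b`:
  `form Π a b = β·fsqB a b + Σ_{μν} Σ_{(κ,λ,ϱ)} spair Π′_{μν,κλϱ} (∂_κ∂_λ∂_ϱ a_μ) b_ν`.  Only the FIRST monomial
  type of (5.38) occurs (as in `B12Rep537.rep538`: the G–K potentials put all three differences on one side); the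
  print's further types "+ Π′_{μν,κ,λϱ} tr(∂_λ∂_ϱδB_μ)(x)(∂_κB_ν)(y) + …" are reshufflings of the same kind
  (`spair_third_order_shift`).
* `form543_of_taylorData3` — the same for the cell's real B12 kernels from (5.10) `B12Sec2to5.Decay510 Π_{μν} C δ₁`
  (every component, `δ₁ > 0`) and the second-order Taylor data (5.36) `B12Rep537.TaylorData3 β μ ν Π_{μν}` (every
  component, one `β`), with `Π′ = B12Rep537.rem538` AND the bound behind (5.44):
  `|Π′_{μν,κλϱ}(z)| ≤ K(δ₁,d)³ (C + |β| MQ(δ₁,d)) e^{−δ₁|z|₁}` (full rate δ₁ in the ℓ¹ distance, constants of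
  `PeriodicGleason` / `B12Rep537`; print: O(1)E₀, rate ½δ₁).
* `form543_of_symmetries` — the same from the four printed properties ALONE: (5.10) for every component, the
  permutation covariance (5.6)/(5.12) `B12Beta.PermCovariant`, the single-axis reflection covariance (5.7)/(5.13)
  `B12Transverse536.ReflCovariant`, and the first Ward identity (5.9)/(5.15) `B12Transverse536.WardFirst`, with
  `β = B12Beta.secondMoment Π μ₀ ν₀ = Σ_x Π_{μ₀ν₀}(x)x_{μ₀}x_{ν₀}` for any fixed `μ₀ ≠ ν₀` ((5.42) = (1.22)) — via
  `B12Transverse536.taylorData3_of_symmetries`.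
* `form543_remainder_shift` — the remainder rewritten "δB once, B twice":
  `Σ spair Π′ (∂_κ∂_λ∂_ϱ a_μ) b_ν = Σ spair Π′ (∂_κ a_μ) (Δ_λΔ_ϱ b_ν)`.
* `form543_forward_of_rep` — the reading with the series' FORWARD curls `B12Pairing543.fsq`: for the REFLECTED
  kernel family `z ↦ Π_{μν}(−z)` (`B12Pairing543Backward.reflK`; for a kernel with the Hessian symmetry (5.8)₂
  Π_{μν}(−z) = Π_{νμ}(z) this is the transposed family), `form (reflK Π) a b = β·fsq a b + (remainder on the
  reflected fields)` (`form_refl`: `form K (refl a) (refl b) = form (reflK K) a b`).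
NOT PROVED HERE / NOT CLAIMED: that the third-order terms are "irrelevant" (this uses the field bounds (4.14)/(4.15)
of §4 — the lineage transcript flags the equation numbers as a probable mis-citation, M-5.45cite, harmless — and the
scaling bookkeeping of §4; out of scope), the cancellation against (4.42) (definition of β_j, p. 298: recorded, not
an estimate), anything about (4.34)/(4.44), and anything about the sign or size of β.  The colour trace and the
𝔤-valued fields are handled componentwise (bilinearity), as certified for the Ward block in `…B12Ward414`.
-/

namespace Literature.MathematicalPhysics.QuantumFieldTheory.Balaban1983to89.B12Form543

noncomputable section

open Literature.MathematicalPhysics.QuantumFieldTheory.GawedzkiKupiainen1985.PeriodicGleason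
open Literature.MathematicalPhysics.QuantumFieldTheory.Balaban1983to89.B12Rep537
open Literature.MathematicalPhysics.QuantumFieldTheory.Balaban1983to89.B12Transverse536
open Literature.MathematicalPhysics.QuantumFieldTheory.Balaban1983to89.B12WardLeadingForm
open Literature.MathematicalPhysics.QuantumFieldTheory.Balaban1983to89.B12Pairing543
open Literature.MathematicalPhysics.QuantumFieldTheory.Balaban1983to89.B12Pairing543Backward

variable {d : ℕ}

/-! ## §1 The objects: finitely supported fields, the scalar pairing, the quadratic form, iterated differences -/

/-- A lattice function vanishing off some finite set (the fields δB, B of (5.43) live in a finite volume).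
[folklore] -/
def FinSupp (f : Pt d → ℂ) : Prop := ∃ A : Finset (Pt d), ∀ x, x ∉ A → f x = 0

/-- A lattice vector field all of whose components vanish off one finite set. [folklore] -/
def FinSuppV (a : Fin d → Pt d → ℂ) : Prop := ∃ A : Finset (Pt d), ∀ μ x, x ∉ A → a μ x = 0

/-- **The scalar pairing** `Σ_{x,y} R(x − y) f(x) g(y)` of two lattice functions through a translation-invariant
kernel, as a `tsum` over `ℤ^d × ℤ^d` (a finite sum for finitely supported `f`, `g`: `spair_eq_sum`).
[cite: Balaban1987RG1, (5.43) p.297 (each summand Π_{μν}(x − y) δB_μ(x) B_ν(y), Π′(x − y)(∂∂∂δB_μ)(x)B_ν(y))] -/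
def spair (R f g : Pt d → ℂ) : ℂ := ∑' p : Pt d × Pt d, R (p.1 - p.2) * f p.1 * g p.2

/-- **The left side of (5.43)**: the quadratic form `Σ_{(x,μ),(y,ν)} Π_{μν}(x − y) a_μ(x) b_ν(y)` of a kernel
family (scalar components). [cite: Balaban1987RG1, (5.43) p.297] -/
def form (K : Fin d → Fin d → Pt d → ℂ) (a b : Fin d → Pt d → ℂ) : ℂ := ∑ μ, ∑ ν, spair (K μ ν) (a μ) (b ν)

/-- Iterated FORWARD differences on a field: `∂_{μs} = ∂_{μs 0} ∘ ∂_{μs 1} ∘ ⋯` (`B12Rep537.fdelta`), the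
`(∂_κ∂_λ∂_ϱ δB_μ)` of (5.43) for `k = 3`. [cite: Balaban1987RG1, (5.43) p.297] -/
def fdeltaIter : (k : ℕ) → (Fin k → Fin d) → (Pt d → ℂ) → Pt d → ℂ
  | 0, _, f => f
  | k + 1, μs, f => fdelta (μs 0) (fdeltaIter k (Fin.tail μs) f)

/-- The complex reading of a real B12 kernel family (`B12Rep537.ofReal` componentwise). [folklore] -/
def ofRealK (P : B12Beta.Kernel d) : Fin d → Fin d → Pt d → ℂ := fun μ ν => ofReal (P μ ν)

/-! ## §2 Finite-support calculus -/

/-- `fdeltaIter 0` is the identity. [folklore] -/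
@[simp] theorem fdeltaIter_zero (μs : Fin 0 → Fin d) (f : Pt d → ℂ) : fdeltaIter 0 μs f = f := rfl

/-- Unfolding one step of `fdeltaIter`. [folklore] -/
theorem fdeltaIter_succ (k : ℕ) (μs : Fin (k + 1) → Fin d) (f : Pt d → ℂ) :
    fdeltaIter (k + 1) μs f = fdelta (μs 0) (fdeltaIter k (Fin.tail μs) f) := rfl

/-- The threefold iterate written out: `∂_κ∂_λ∂_ϱ f`. [folklore] -/
theorem fdeltaIter_three (μs : Fin 3 → Fin d) (f : Pt d → ℂ) :
    fdeltaIter 3 μs f = fdelta (μs 0) (fdelta (μs 1) (fdelta (μs 2) f)) := rfl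

/-- Forward differences commute with the iterate (all forward differences commute). [folklore] -/
theorem fdeltaIter_fdelta (k : ℕ) : ∀ (μs : Fin k → Fin d) (μ : Fin d) (f : Pt d → ℂ),
    fdeltaIter k μs (fdelta μ f) = fdelta μ (fdeltaIter k μs f) := by
  induction k with
  | zero => intro μs μ f; rfl
  | succ k ih => intro μs μ f; rw [fdeltaIter_succ, fdeltaIter_succ, ih, fdelta_comm]

/-- A translate of a finitely supported function is finitely supported. [folklore] -/
theorem FinSupp.shift {f : Pt d → ℂ} (hf : FinSupp f) (v : Pt d) : FinSupp fun x => f (x + v) := by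
  obtain ⟨A, hA⟩ := hf
  refine ⟨A.image fun x => x - v, fun x hx => hA _ fun hmem => hx ?_⟩
  exact Finset.mem_image.mpr ⟨x + v, hmem, by simp⟩

/-- The same for a translate written with a subtraction. [folklore] -/
theorem FinSupp.shift_sub {f : Pt d → ℂ} (hf : FinSupp f) (v : Pt d) : FinSupp fun x => f (x - v) := by
  obtain ⟨A, hA⟩ := hf
  refine ⟨A.image fun x => x + v, fun x hx => hA _ fun hmem => hx ?_⟩
  exact Finset.mem_image.mpr ⟨x - v, hmem, by simp⟩

/-- A forward difference of a finitely supported function is finitely supported. [folklore] -/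
theorem FinSupp.fdelta {f : Pt d → ℂ} (hf : FinSupp f) (μ : Fin d) : FinSupp (fdelta μ f) := by
  obtain ⟨A₁, h₁⟩ := hf.shift (unitVec μ)
  obtain ⟨A₀, h₀⟩ := hf
  refine ⟨A₀ ∪ A₁, fun x hx => ?_⟩
  rw [Finset.mem_union, not_or] at hx
  have e₁ : f (x + unitVec μ) = 0 := h₁ x hx.2
  simp only [B12Rep537.fdelta, e₁, h₀ x hx.1, sub_zero]

/-- A backward-looking difference of a finitely supported function is finitely supported. [folklore] -/
theorem FinSupp.delta {f : Pt d → ℂ} (hf : FinSupp f) (μ : Fin d) : FinSupp (delta μ f) := by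
  obtain ⟨A₁, h₁⟩ := hf.shift_sub (unitVec μ)
  obtain ⟨A₀, h₀⟩ := hf
  refine ⟨A₀ ∪ A₁, fun x hx => ?_⟩
  rw [Finset.mem_union, not_or] at hx
  have e₁ : f (x - unitVec μ) = 0 := h₁ x hx.2
  simp only [GawedzkiKupiainen1985.PeriodicGleason.delta, e₁, h₀ x hx.1, sub_zero]

/-- Iterated forward differences preserve finite support. [folklore] -/
theorem FinSupp.fdeltaIter {f : Pt d → ℂ} (hf : FinSupp f) (k : ℕ) :
    ∀ μs : Fin k → Fin d, FinSupp (fdeltaIter k μs f) := by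
  induction k with
  | zero => intro μs; exact hf
  | succ k ih => intro μs; rw [fdeltaIter_succ]; exact (ih _).fdelta _

/-- The reflected function `x ↦ f(−x)` of a finitely supported function is finitely supported. [folklore] -/
theorem FinSupp.neg {f : Pt d → ℂ} (hf : FinSupp f) : FinSupp fun x => f (-x) := by
  obtain ⟨A, hA⟩ := hf
  refine ⟨A.image Neg.neg, fun x hx => hA _ fun hmem => hx ?_⟩
  exact Finset.mem_image.mpr ⟨-x, hmem, neg_neg x⟩

/-- Components of a finitely supported vector field are finitely supported. [folklore] -/
theorem FinSuppV.comp {a : Fin d → Pt d → ℂ} (ha : FinSuppV a) (μ : Fin d) : FinSupp (a μ) := by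
  obtain ⟨A, hA⟩ := ha
  exact ⟨A, hA μ⟩

/-- A field vanishing off a given finite set is finitely supported (the hypothesis shape of `B12Pairing543`).
[folklore] -/
theorem finSuppV_of_support {A : Finset (Pt d)} {a : Fin d → Pt d → ℂ} (ha : ∀ μ x, x ∉ A → a μ x = 0) :
    FinSuppV a := ⟨A, ha⟩

/-- The reflected field `B12Pairing543Backward.refl a` of a finitely supported field is finitely supported.
[folklore] -/
theorem FinSuppV.refl {a : Fin d → Pt d → ℂ} (ha : FinSuppV a) : FinSuppV (refl a) := by
  obtain ⟨A, hA⟩ := ha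
  exact ⟨A.image Neg.neg, refl_support hA⟩

/-- The summand of `spair` is summable: it vanishes off `A × B`. [folklore] -/
theorem summable_spairFun (R : Pt d → ℂ) {f g : Pt d → ℂ} (hf : FinSupp f) (hg : FinSupp g) :
    Summable fun p : Pt d × Pt d => R (p.1 - p.2) * f p.1 * g p.2 := by
  obtain ⟨A, hA⟩ := hf
  obtain ⟨B, hB⟩ := hg
  refine summable_of_ne_finset_zero (s := A ×ˢ B) fun p hp => ?_
  rw [Finset.mem_product, not_and_or] at hp
  rcases hp with h | h
  · simp [hA _ h]
  · simp [hB _ h]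

/-- **`spair` is the finite double sum** over any finite sets off which the fields vanish.
[cite: Balaban1987RG1, (5.43) p.297] -/
theorem spair_eq_sum {R f g : Pt d → ℂ} {A B : Finset (Pt d)} (hA : ∀ x, x ∉ A → f x = 0)
    (hB : ∀ y, y ∉ B → g y = 0) :
    spair R f g = ∑ x ∈ A, ∑ y ∈ B, R (x - y) * f x * g y := by
  unfold spair
  rw [tsum_eq_sum (s := A ×ˢ B), Finset.sum_product]
  intro p hp
  rw [Finset.mem_product, not_and_or] at hp
  rcases hp with h | h
  · simp [hA _ h]
  · simp [hB _ h]

/-- **The left side of (5.43) is `B12Pairing543.pairing`** for fields vanishing off finite sets `A`, `B`: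
`form K a b = Σ_{x∈A} Σ_{y∈B} Σ_{μν} K_{μν}(x − y) a_μ(x) b_ν(y)`. [cite: Balaban1987RG1, (5.43) p.297] -/
theorem form_eq_pairing {K : Fin d → Fin d → Pt d → ℂ} {a b : Fin d → Pt d → ℂ} {A B : Finset (Pt d)}
    (ha : ∀ μ x, x ∉ A → a μ x = 0) (hb : ∀ ν y, y ∉ B → b ν y = 0) :
    form K a b = pairing K A B a b := by
  have h : ∀ μ ν, spair (K μ ν) (a μ) (b ν) = ∑ x ∈ A, ∑ y ∈ B, K μ ν (x - y) * a μ x * b ν y :=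
    fun μ ν => spair_eq_sum (ha μ) (hb ν)
  simp only [form, pairing, h]
  exact sum4_comm A B _

/-! ## §3 Linearity of the pairing in the kernel -/

/-- Additivity in the kernel. [folklore] -/
theorem spair_add_kernel (R₁ R₂ : Pt d → ℂ) {f g : Pt d → ℂ} (hf : FinSupp f) (hg : FinSupp g) :
    spair (R₁ + R₂) f g = spair R₁ f g + spair R₂ f g := by
  unfold spair
  rw [← (summable_spairFun R₁ hf hg).tsum_add (summable_spairFun R₂ hf hg)]
  exact tsum_congr fun p => by simp only [Pi.add_apply]; ring

/-- Homogeneity in the kernel. [folklore] -/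
theorem spair_mul_kernel (c : ℂ) (R : Pt d → ℂ) (f g : Pt d → ℂ) :
    spair (fun z => c * R z) f g = c * spair R f g := by
  unfold spair
  rw [← tsum_mul_left]
  exact tsum_congr fun p => by ring

/-- Finite sums in the kernel. [folklore] -/
theorem spair_sum_kernel {ι : Type*} (s : Finset ι) (S : ι → Pt d → ℂ) {f g : Pt d → ℂ} (hf : FinSupp f)
    (hg : FinSupp g) : spair (fun z => ∑ i ∈ s, S i z) f g = ∑ i ∈ s, spair (S i) f g := by
  classical
  induction s using Finset.induction_on with
  | empty => simp [spair]
  | insert i s hi ih =>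
    rw [Finset.sum_insert hi, ← ih, ← spair_add_kernel _ _ hf hg]
    exact congrArg (fun R => spair R f g) (funext fun z => by simp [Finset.sum_insert hi])

/-! ## §4 Summation by parts -/

/-- Re-indexing the pair sum by a translation of the first variable. [folklore] -/
theorem tsum_shift_fst (F : Pt d × Pt d → ℂ) (v : Pt d) :
    ∑' p : Pt d × Pt d, F (p.1 + v, p.2) = ∑' p : Pt d × Pt d, F p :=
  Equiv.tsum_eq ((Equiv.addRight v).prodCongr (Equiv.refl (Pt d))) F

/-- Re-indexing the pair sum by a translation of the second variable. [folklore] -/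
theorem tsum_shift_snd (F : Pt d × Pt d → ℂ) (v : Pt d) :
    ∑' p : Pt d × Pt d, F (p.1, p.2 + v) = ∑' p : Pt d × Pt d, F p :=
  Equiv.tsum_eq ((Equiv.refl (Pt d)).prodCongr (Equiv.addRight v)) F

/-- Re-indexing the pair sum by the reflection of both variables. [folklore] -/
theorem tsum_neg_neg (F : Pt d × Pt d → ℂ) :
    ∑' p : Pt d × Pt d, F (-p.1, -p.2) = ∑' p : Pt d × Pt d, F p :=
  Equiv.tsum_eq ((Equiv.neg (Pt d)).prodCongr (Equiv.neg (Pt d))) F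

/-- **Summation by parts, kernel ↔ left field**: a BACKWARD-LOOKING difference `Δ_μ` (`PeriodicGleason.delta`,
symbol \overline{∂_μ(p)}) on the kernel is the FORWARD difference `∂_μ` (`B12Rep537.fdelta`) on the left field:
`Σ_{x,y} (Δ_μR)(x − y) f(x) g(y) = Σ_{x,y} R(x − y) (∂_μ f)(x) g(y)`.
[cite: Balaban1987RG1, (5.43) p.297 ("using (5.37), (5.38)": the passage from \overline{∂}\overline{∂}\overline{∂}
on Π′ to ∂_κ∂_λ∂_ϱ on δB)] -/
theorem spair_delta_kernel (R : Pt d → ℂ) (μ : Fin d) {f g : Pt d → ℂ} (hf : FinSupp f) (hg : FinSupp g) :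
    spair (delta μ R) f g = spair R (fdelta μ f) g := by
  have hF := summable_spairFun R hf hg
  have hH := summable_spairFun (fun z => R (z - unitVec μ)) hf hg
  have hG := summable_spairFun R (hf.shift (unitVec μ)) hg
  have hre : ∑' p : Pt d × Pt d, R (p.1 - p.2 - unitVec μ) * f p.1 * g p.2 =
      ∑' p : Pt d × Pt d, R (p.1 - p.2) * f (p.1 + unitVec μ) * g p.2 := by
    rw [← tsum_shift_fst (fun p : Pt d × Pt d => R (p.1 - p.2 - unitVec μ) * f p.1 * g p.2) (unitVec μ)]
    exact tsum_congr fun p => by simp only [add_sub_right_comm, sub_add_cancel]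
  unfold spair
  calc ∑' p : Pt d × Pt d, delta μ R (p.1 - p.2) * f p.1 * g p.2
      = ∑' p : Pt d × Pt d, (R (p.1 - p.2 - unitVec μ) * f p.1 * g p.2 - R (p.1 - p.2) * f p.1 * g p.2) :=
        tsum_congr fun p => by simp only [delta]; ring
    _ = ∑' p : Pt d × Pt d, R (p.1 - p.2 - unitVec μ) * f p.1 * g p.2 -
          ∑' p : Pt d × Pt d, R (p.1 - p.2) * f p.1 * g p.2 := hH.tsum_sub hF
    _ = ∑' p : Pt d × Pt d, R (p.1 - p.2) * f (p.1 + unitVec μ) * g p.2 -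
          ∑' p : Pt d × Pt d, R (p.1 - p.2) * f p.1 * g p.2 := by rw [hre]
    _ = ∑' p : Pt d × Pt d, (R (p.1 - p.2) * f (p.1 + unitVec μ) * g p.2 - R (p.1 - p.2) * f p.1 * g p.2) :=
        (hG.tsum_sub hF).symm
    _ = ∑' p : Pt d × Pt d, R (p.1 - p.2) * fdelta μ f p.1 * g p.2 :=
        tsum_congr fun p => by simp only [B12Rep537.fdelta]; ring

/-- **Summation by parts, kernel ↔ right field**: the backward-looking difference on the kernel is also the
backward-looking difference on the RIGHT field: `Σ (Δ_μR)(x − y) f(x) g(y) = Σ R(x − y) f(x) (Δ_μ g)(y)`.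
[cite: Balaban1987RG1, p.298 ("we can always shift the derivatives onto the other function")] -/
theorem spair_delta_kernel_right (R : Pt d → ℂ) (μ : Fin d) {f g : Pt d → ℂ} (hf : FinSupp f)
    (hg : FinSupp g) : spair (delta μ R) f g = spair R f (delta μ g) := by
  have hF := summable_spairFun R hf hg
  have hH := summable_spairFun (fun z => R (z - unitVec μ)) hf hg
  have hG := summable_spairFun R hf (hg.shift_sub (unitVec μ))
  have hre : ∑' p : Pt d × Pt d, R (p.1 - p.2 - unitVec μ) * f p.1 * g p.2 =
      ∑' p : Pt d × Pt d, R (p.1 - p.2) * f p.1 * g (p.2 - unitVec μ) := by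
    rw [← tsum_shift_snd (fun p : Pt d × Pt d => R (p.1 - p.2) * f p.1 * g (p.2 - unitVec μ)) (unitVec μ)]
    exact tsum_congr fun p => by simp only [sub_sub, add_sub_cancel_right]
  unfold spair
  calc ∑' p : Pt d × Pt d, delta μ R (p.1 - p.2) * f p.1 * g p.2
      = ∑' p : Pt d × Pt d, (R (p.1 - p.2 - unitVec μ) * f p.1 * g p.2 - R (p.1 - p.2) * f p.1 * g p.2) :=
        tsum_congr fun p => by simp only [delta]; ring
    _ = ∑' p : Pt d × Pt d, R (p.1 - p.2 - unitVec μ) * f p.1 * g p.2 -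
          ∑' p : Pt d × Pt d, R (p.1 - p.2) * f p.1 * g p.2 := hH.tsum_sub hF
    _ = ∑' p : Pt d × Pt d, R (p.1 - p.2) * f p.1 * g (p.2 - unitVec μ) -
          ∑' p : Pt d × Pt d, R (p.1 - p.2) * f p.1 * g p.2 := by rw [hre]
    _ = ∑' p : Pt d × Pt d, (R (p.1 - p.2) * f p.1 * g (p.2 - unitVec μ) - R (p.1 - p.2) * f p.1 * g p.2) :=
        (hG.tsum_sub hF).symm
    _ = ∑' p : Pt d × Pt d, R (p.1 - p.2) * f p.1 * delta μ g p.2 :=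
        tsum_congr fun p => by simp only [delta]; ring

/-- **"Shift the derivatives onto the other function"** (p. 298): a forward difference on the left field is a
backward-looking difference on the right field, `Σ R(x − y)(∂_μ f)(x) g(y) = Σ R(x − y) f(x) (Δ_μ g)(y)`.
[cite: Balaban1987RG1, p.298 (first sentence)] -/
theorem spair_fdelta_left_eq_delta_right (R : Pt d → ℂ) (μ : Fin d) {f g : Pt d → ℂ} (hf : FinSupp f)
    (hg : FinSupp g) : spair R (fdelta μ f) g = spair R f (delta μ g) := by
  rw [← spair_delta_kernel R μ hf hg, spair_delta_kernel_right R μ hf hg]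

/-- **Iterated summation by parts**: `Σ (Δ_{μs}R)(x − y) f(x) g(y) = Σ R(x − y) (∂_{μs} f)(x) g(y)` — the `k`
backward-looking differences of `PeriodicGleason.deltaIter` on the kernel become `k` forward differences on the
left field. [cite: Balaban1987RG1, (5.43) p.297] -/
theorem spair_deltaIter_kernel (k : ℕ) : ∀ (μs : Fin k → Fin d) (R : Pt d → ℂ) {f g : Pt d → ℂ},
    FinSupp f → FinSupp g → spair (deltaIter k μs R) f g = spair R (fdeltaIter k μs f) g := by
  induction k with
  | zero => intro μs R f g _ _; rfl
  | succ k ih =>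
    intro μs R f g hf hg
    show spair (delta (μs 0) (deltaIter k (Fin.tail μs) R)) f g = _
    rw [spair_delta_kernel _ _ hf hg, ih _ _ (hf.fdelta _) hg, fdeltaIter_fdelta, fdeltaIter_succ]

/-- **"δB is differentiated once, and B twice"** (p. 298): the third-order remainder monomial reshuffled,
`Σ Π′(x − y)(∂_κ∂_λ∂_ϱ f)(x) g(y) = Σ Π′(x − y)(∂_κ f)(x)(Δ_λΔ_ϱ g)(y)`.
[cite: Balaban1987RG1, p.298 (first sentence); (5.43) p.297] -/
theorem spair_third_order_shift (R : Pt d → ℂ) (μs : Fin 3 → Fin d) {f g : Pt d → ℂ} (hf : FinSupp f)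
    (hg : FinSupp g) :
    spair R (fdeltaIter 3 μs f) g = spair R (fdelta (μs 0) f) (delta (μs 1) (delta (μs 2) g)) := by
  rw [fdeltaIter_three, fdelta_comm (μs 0) (μs 1),
    spair_fdelta_left_eq_delta_right R (μs 1) ((hf.fdelta _).fdelta _) hg, fdelta_comm (μs 0) (μs 2),
    spair_fdelta_left_eq_delta_right R (μs 2) (hf.fdelta _) (hg.delta _), delta_comm]

/-- **Reflection acts on the kernel by `z ↦ −z`**: `Σ R(x − y) f(−x) g(−y) = Σ R(−(x − y)) f(x) g(y)`.
[folklore] -/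
theorem spair_refl (R f g : Pt d → ℂ) :
    spair R (fun x => f (-x)) (fun y => g (-y)) = spair (fun z => R (-z)) f g := by
  unfold spair
  rw [← tsum_neg_neg (fun p : Pt d × Pt d => R (p.1 - p.2) * (fun x => f (-x)) p.1 * (fun y => g (-y)) p.2)]
  exact tsum_congr fun p => by simp only [neg_neg, neg_sub_neg, neg_sub]

/-- **`form` under reflection of both fields** = `form` of the reflected kernel family
(`B12Pairing543Backward.refl`, `reflK`). [folklore] -/
theorem form_refl (K : Fin d → Fin d → Pt d → ℂ) (a b : Fin d → Pt d → ℂ) :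
    form K (refl a) (refl b) = form (reflK K) a b := by
  simp only [form]
  exact Finset.sum_congr rfl fun μ _ => Finset.sum_congr rfl fun ν _ => spair_refl (K μ ν) (a μ) (b ν)

/-! ## §5 The display (5.43), complete -/

/-- **The printed leading kernel pairs to the backward-curl square** (`B12Pairing543Backward.fsqB_eq_pairing_printed`
in the `form` language): `form Q a b = fsqB a b = ½Σ_xΣ_{μν}(curlB a)_{μν}(x)(curlB b)_{μν}(x)`.
[cite: Balaban1987RG1, (5.43) p.297 (first right-hand term); (5.16) p.293; (5.36)–(5.37) p.297] -/
theorem form_wilsonQ {a b : Fin d → Pt d → ℂ} (ha : FinSuppV a) (hb : FinSuppV b) :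
    form wilsonQ a b = fsqB a b := by
  obtain ⟨A, hA⟩ := ha
  obtain ⟨B, hB⟩ := hb
  rw [form_eq_pairing hA hB, fsqB_eq_pairing_printed hA hB]

/-- **(5.43) COMPLETE, as an identity.**  If a complex kernel family `Π` has the coefficient representation
(5.37)/(5.38) `Π_{μν}(z) − βQ_{μν}(z) = Σ_{(κ,λ,ϱ)} (Δ_κΔ_λΔ_ϱ Π′_{μν,κλϱ})(z)` (backward-looking differences on
the kernel; `Q = wilsonQ`), then for all finitely supported fields `a = δB`, `b = B`:
`Σ_{(x,μ),(y,ν)} Π_{μν}(x − y) a_μ(x) b_ν(y) = β·½Σ_xΣ_{μν}(curlB a)_{μν}(x)(curlB b)_{μν}(x)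
 + Σ_{μν} Σ_{(κ,λ,ϱ)} Σ_{x,y} Π′_{μν,κλϱ}(x − y) (∂_κ∂_λ∂_ϱ a_μ)(x) b_ν(y)` (forward ∂ on the left field).
[cite: Balaban1987RG1, (5.43) p.297] -/
theorem form543_of_rep {Pc : Fin d → Fin d → Pt d → ℂ} {β : ℂ} {R : Fin d → Fin d → (Fin 3 → Fin d) → Pt d → ℂ}
    (hPc : ∀ μ ν z, Pc μ ν z - β * wilsonQ μ ν z = ∑ μs : Fin 3 → Fin d, deltaIter 3 μs (R μ ν μs) z)
    {a b : Fin d → Pt d → ℂ} (ha : FinSuppV a) (hb : FinSuppV b) :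
    form Pc a b = β * fsqB a b +
      ∑ μ, ∑ ν, ∑ μs : Fin 3 → Fin d, spair (R μ ν μs) (fdeltaIter 3 μs (a μ)) (b ν) := by
  have hfa : ∀ μ, FinSupp (a μ) := ha.comp
  have hfb : ∀ ν, FinSupp (b ν) := hb.comp
  have step : ∀ μ ν, spair (Pc μ ν) (a μ) (b ν) = β * spair (wilsonQ μ ν) (a μ) (b ν) +
      ∑ μs : Fin 3 → Fin d, spair (R μ ν μs) (fdeltaIter 3 μs (a μ)) (b ν) := by
    intro μ ν
    have e : Pc μ ν = (fun z => β * wilsonQ μ ν z) +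
        fun z => ∑ μs : Fin 3 → Fin d, deltaIter 3 μs (R μ ν μs) z := by
      funext z
      simp only [Pi.add_apply]
      rw [← hPc μ ν z]
      ring
    rw [e, spair_add_kernel _ _ (hfa μ) (hfb ν), spair_mul_kernel, spair_sum_kernel _ _ (hfa μ) (hfb ν)]
    congr 1
    exact Finset.sum_congr rfl fun μs _ => spair_deltaIter_kernel 3 μs _ (hfa μ) (hfb ν)
  rw [← form_wilsonQ ha hb]
  simp only [form, step, Finset.sum_add_distrib, Finset.mul_sum]

/-- **(5.43) with the remainder reshuffled "δB once, B twice"** (p. 298): under the same representation,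
`form Π a b = β·fsqB a b + Σ_{μν} Σ_{(κ,λ,ϱ)} Σ_{x,y} Π′_{μν,κλϱ}(x − y) (∂_κ a_μ)(x) (Δ_λΔ_ϱ b_ν)(y)`.
[cite: Balaban1987RG1, (5.43) p.297; p.298 (first sentence)] -/
theorem form543_remainder_shift {Pc : Fin d → Fin d → Pt d → ℂ} {β : ℂ}
    {R : Fin d → Fin d → (Fin 3 → Fin d) → Pt d → ℂ}
    (hPc : ∀ μ ν z, Pc μ ν z - β * wilsonQ μ ν z = ∑ μs : Fin 3 → Fin d, deltaIter 3 μs (R μ ν μs) z)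
    {a b : Fin d → Pt d → ℂ} (ha : FinSuppV a) (hb : FinSuppV b) :
    form Pc a b = β * fsqB a b +
      ∑ μ, ∑ ν, ∑ μs : Fin 3 → Fin d,
        spair (R μ ν μs) (fdelta (μs 0) (a μ)) (delta (μs 1) (delta (μs 2) (b ν))) := by
  rw [form543_of_rep hPc ha hb]
  congr 1
  exact Finset.sum_congr rfl fun μ _ => Finset.sum_congr rfl fun ν _ => Finset.sum_congr rfl fun μs _ =>
    spair_third_order_shift _ μs (ha.comp μ) (hb.comp ν)

/-- **(5.43) read with the series' FORWARD curls** (`B12Pairing543.fsq`, Bałaban CMP 95 p. 18 (1.2)): for the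
REFLECTED kernel family `z ↦ Π_{μν}(−z)` the leading term is `β·fsq a b`, the remainder being the backward one on
the reflected fields (`form_refl`, `B12Pairing543Backward.fsq_eq_fsqB_refl`).  For a kernel with the Hessian
symmetry (5.8)₂ `Π_{μν}(−z) = Π_{νμ}(z)` the reflected family is the transposed one — the located forward/backward
(= transposition) convention slip of GAPS G-b03g6-4, harmless. [cite: Balaban1987RG1, (5.43) p.297; (5.8) p.293] -/
theorem form543_forward_of_rep {Pc : Fin d → Fin d → Pt d → ℂ} {β : ℂ}
    {R : Fin d → Fin d → (Fin 3 → Fin d) → Pt d → ℂ}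
    (hPc : ∀ μ ν z, Pc μ ν z - β * wilsonQ μ ν z = ∑ μs : Fin 3 → Fin d, deltaIter 3 μs (R μ ν μs) z)
    {a b : Fin d → Pt d → ℂ} (ha : FinSuppV a) (hb : FinSuppV b) :
    form (reflK Pc) a b = β * fsq a b +
      ∑ μ, ∑ ν, ∑ μs : Fin 3 → Fin d, spair (R μ ν μs) (fdeltaIter 3 μs (refl a μ)) (refl b ν) := by
  rw [← form_refl, form543_of_rep hPc ha.refl hb.refl, fsq_eq_fsqB_refl]

/-- **(5.43) complete for the cell's real B12 kernels, from (5.10) + (5.36), with the bound behind (5.44).**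
If every component has the decay (5.10) `|Π_{μν}(z)| ≤ C e^{−δ₁|z|₁}`, `δ₁ > 0`, and second-order Taylor data
`β ×` those of `Q_{μν}` ((5.36)/(5.37)), then for all finitely supported `a`, `b` the identity of
`form543_of_rep` holds with `Π′ = B12Rep537.rem538`, AND `|Π′_{μν,κλϱ}(z)| ≤ K(δ₁,d)³(C + |β|MQ(δ₁,d))e^{−δ₁|z|₁}`.
[cite: Balaban1987RG1, (5.43)–(5.44) p.297; (5.37)–(5.38) p.297; (5.10) p.293] -/
theorem form543_of_taylorData3 {P : B12Beta.Kernel d} {C δ₁ : ℝ} {β : ℂ} (hδ : 0 < δ₁)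
    (h510 : ∀ μ ν, B12Sec2to5.Decay510 (P μ ν) C δ₁) (hT : ∀ μ ν, TaylorData3 β μ ν (ofReal (P μ ν)))
    {a b : Fin d → Pt d → ℂ} (ha : FinSuppV a) (hb : FinSuppV b) :
    form (ofRealK P) a b = β * fsqB a b +
        ∑ μ, ∑ ν, ∑ μs : Fin 3 → Fin d,
          spair (rem538 (ofReal (P μ ν)) β μ ν μs) (fdeltaIter 3 μs (a μ)) (b ν) ∧
      ∀ (μ ν : Fin d) (μs : Fin 3 → Fin d) (z : Pt d),
        ‖rem538 (ofReal (P μ ν)) β μ ν μs z‖ ≤ K δ₁ d ^ 3 * (C + ‖β‖ * MQ δ₁ d) * Real.exp (-δ₁ * l1 z) :=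
  ⟨form543_of_rep (Pc := ofRealK P) (fun μ ν z => (rep538_of_decay510 hδ (h510 μ ν) (hT μ ν)).1 z) ha hb,
    fun μ ν μs z => (rep538_of_decay510 hδ (h510 μ ν) (hT μ ν)).2 μs z⟩

/-- **(5.43) complete from the four printed properties alone — (5.10), (5.6)/(5.12), (5.7)/(5.13), (5.9)₁/(5.15) —
with β = (5.42) = (1.22).**  For a real kernel family with the decay (5.10) of every component, permutation
covariance, single-axis reflection covariance and the first Ward identity, and any fixed `μ₀ ≠ ν₀`:
with `β = Σ_x Π_{μ₀ν₀}(x)x_{μ₀}x_{ν₀}` (`B12Beta.secondMoment`), for all finitely supported `a = δB`, `b = B`,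
`Σ_{(x,μ),(y,ν)} Π_{μν}(x − y) a_μ(x) b_ν(y) = β·½Σ_xΣ_{μν}(curlB a)_{μν}(curlB b)_{μν}
 + Σ_{μν}Σ_{(κ,λ,ϱ)}Σ_{x,y} Π′_{μν,κλϱ}(x − y)(∂_κ∂_λ∂_ϱ a_μ)(x) b_ν(y)`, `|Π′(z)| ≤ K(δ₁,d)³(C + |β|MQ(δ₁,d))e^{−δ₁|z|₁}`.
[cite: Balaban1987RG1, (5.43)–(5.44) p.297; (5.42) p.297; (5.6), (5.7), (5.9), (5.10) p.293] -/
theorem form543_of_symmetries {P : B12Beta.Kernel d} {C δ₁ : ℝ} (hδ : 0 < δ₁)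
    (h510 : ∀ μ ν, B12Sec2to5.Decay510 (P μ ν) C δ₁) (hperm : B12Beta.PermCovariant P)
    (hrefl : ReflCovariant P) (hward : WardFirst P) {μ₀ ν₀ : Fin d} (h0 : μ₀ ≠ ν₀)
    {a b : Fin d → Pt d → ℂ} (ha : FinSuppV a) (hb : FinSuppV b) :
    form (ofRealK P) a b = ((B12Beta.secondMoment P μ₀ ν₀ : ℝ) : ℂ) * fsqB a b +
        ∑ μ, ∑ ν, ∑ μs : Fin 3 → Fin d,
          spair (rem538 (ofReal (P μ ν)) ((B12Beta.secondMoment P μ₀ ν₀ : ℝ) : ℂ) μ ν μs)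
            (fdeltaIter 3 μs (a μ)) (b ν) ∧
      ∀ (μ ν : Fin d) (μs : Fin 3 → Fin d) (z : Pt d),
        ‖rem538 (ofReal (P μ ν)) ((B12Beta.secondMoment P μ₀ ν₀ : ℝ) : ℂ) μ ν μs z‖ ≤
          K δ₁ d ^ 3 * (C + ‖((B12Beta.secondMoment P μ₀ ν₀ : ℝ) : ℂ)‖ * MQ δ₁ d) * Real.exp (-δ₁ * l1 z) :=
  form543_of_taylorData3 hδ h510 (fun μ ν => taylorData3_of_symmetries hδ h510 hperm hrefl hward h0 μ ν) ha hb

/-! ## §6 Sanity: the objects on bond fields -/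

/-- The pairing of two bond fields through `form` is the kernel entry: `form K (bvec μ₀ x₀) (bvec ν₀ y₀) =
K_{μ₀ν₀}(x₀ − y₀)` (`B12Pairing543.pairing_bvec`). [folklore] -/
theorem form_bvec (K : Fin d → Fin d → Pt d → ℂ) (μ₀ ν₀ : Fin d) (x₀ y₀ : Pt d) :
    form K (bvec μ₀ x₀) (bvec ν₀ y₀) = K μ₀ ν₀ (x₀ - y₀) := by
  rw [form_eq_pairing (bvec_support μ₀ x₀) (bvec_support ν₀ y₀), pairing_bvec]

end

end Literature.MathematicalPhysics.QuantumFieldTheory.Balaban1983to89.B12Form543
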